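import Mathlib.MeasureTheory.Integral.Prod
import Mathlib.MeasureTheory.Constructions.Pi
import Mathlib.Analysis.SpecialFunctions.Integrals.Basic
import Literature.NumberTheory.Transcendental.KZCalculus
import Summits.KontsevichZagierPeriods.KontsevichZagierPeriods.Theorems.TorsionLogsNeronTorsionFlexRepValues
import HarnessLib

/-!
# Route `TorsionLogs`, crux `TorsionSectorComplete` (stmt-KontsevichZagierPeriods-14212), line
# `NeronTorsionModularArc` — measure-theoretic plumbing for the modular-arc value identity

Pure measure theory (no elliptic functions), serving the on-path lander's target `ArcValueIdentity` of
`Cruxes/TorsionSectorComplete/Lines/NeronTorsionArcs_onpath.lean` (rung `NeronTorsionArcs`):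

* **slices over the LAST coordinate** of `ℝⁿ⁺¹` (`z = Fin.snoc x s`, parameter `s = z (Fin.last n)`):
  `measurePreserving_snoc`, `integral_integral_lastSlice` (Fubini: the slice set-integrals of an
  integrable set integral integrate to it), `integrable_integral_lastSlice`, `ae_integrableOn_lastSlice`
  — the last-coordinate companion of `Literature/…/KZSliceFubini.lean` (first coordinate, `vecCons`),
  stated for a measurable set and an integrable function rather than a `KZ.IntegralRep`, because the
  fibres of a fibred representation over a transcendental parameter are not `ℚ`-semialgebraic;
* **raw fibre evaluations** on `Fin 2 → ℝ`: `setIntegral_triangle_eq` and `setIntegral_quadrant_eq` — the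
  bodies of `value_triangle_eq` / `value_quadrant_eq` (`TorsionLogsNeronTorsionFlexRepValues.lean`) with an
  `IntegrableOn` hypothesis in place of an `IntegralRep 2`;
* **the log box**: `integral_logBox_fibre` (`∫₀¹ (b−1)/(1+u(b−1)) du = log b` for every `b > 0`, both signs
  of `b − 1`), `value_logBox_eq` (a dimension-2 representation over the box `0<u<1, t₀<t<t₁` with integrand
  `(B(t)−1)/(1+u(B(t)−1))` has value `∫_{t₀}^{t₁} log B(t) dt` when `B > 0` on the arc) and
  `integrableOn_log_of_logBox` (then `log B` is integrable on the arc).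

prover-fwd2-land-3-g27-0 (on-path lander, assist on candidates row idx 8), 2026-08-19.
[cite: KontsevichZagier2001, §1.1]
-/

-- single-conjunct summit: Sub = Summit, so the namespace segment repeats by design (CONVENTIONS §2)
set_option linter.dupNamespace false

noncomputable section

open Set MeasureTheory
open Literature.NumberTheory.Transcendental
open Summit.KontsevichZagierPeriods.KontsevichZagierPeriods.TorsionLogs.NeronDuplication
  (setIntegral_fin_two_eq_prod integrableOn_prod_of_fin_two)

namespace Summit.KontsevichZagierPeriods.KontsevichZagierPeriods.TorsionLogs.NeronTorsionModularArc

variable {n : ℕ}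

/-! ### The map `(s, x) ↦ Fin.snoc x s` (parameter last) -/

/-- `x ↦ Fin.snoc x s : ℝⁿ → ℝⁿ⁺¹` is measurable. [folklore] -/
theorem measurable_snoc (s : ℝ) :
    Measurable fun x : Fin n → ℝ => (Fin.snoc x s : Fin (n + 1) → ℝ) := by
  refine measurable_pi_lambda _ fun j => ?_
  refine Fin.lastCases ?_ (fun k => ?_) j
  · simp only [Fin.snoc_last]; exact measurable_const
  · simp only [Fin.snoc_castSucc]; exact measurable_pi_apply k

/-- Each last-coordinate slice `{x | Fin.snoc x s ∈ D}` of a measurable set is measurable. [folklore] -/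
theorem measurableSet_lastSlice {D : Set (Fin (n + 1) → ℝ)} (hD : MeasurableSet D) (s : ℝ) :
    MeasurableSet {x : Fin n → ℝ | (Fin.snoc x s : Fin (n + 1) → ℝ) ∈ D} :=
  measurable_snoc s hD

/-- The inverse of `MeasurableEquiv.piFinSuccAbove (fun _ => ℝ) (Fin.last n) : ℝⁿ⁺¹ ≃ᵐ ℝ × ℝⁿ` is
`(s, x) ↦ Fin.snoc x s`. [folklore] -/
theorem piFinSuccAbove_last_symm_apply (p : ℝ × (Fin n → ℝ)) :
    (MeasurableEquiv.piFinSuccAbove (fun _ : Fin (n + 1) => ℝ) (Fin.last n)).symm p =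
      (Fin.snoc p.2 p.1 : Fin (n + 1) → ℝ) := by
  rw [← Fin.insertNth_last']
  rfl

/-- `(s, x) ↦ Fin.snoc x s` is the inverse of `MeasurableEquiv.piFinSuccAbove (fun _ => ℝ) (Fin.last n)`,
as functions. [folklore] -/
theorem snoc_eq_piFinSuccAbove_symm :
    (fun p : ℝ × (Fin n → ℝ) => (Fin.snoc p.2 p.1 : Fin (n + 1) → ℝ)) =
      ⇑(MeasurableEquiv.piFinSuccAbove (fun _ : Fin (n + 1) => ℝ) (Fin.last n)).symm :=
  funext fun p => (piFinSuccAbove_last_symm_apply p).symm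

/-- `(s, x) ↦ Fin.snoc x s : ℝ × ℝⁿ → ℝⁿ⁺¹` is a measurable embedding. [folklore] -/
theorem measurableEmbedding_snoc :
    MeasurableEmbedding fun p : ℝ × (Fin n → ℝ) => (Fin.snoc p.2 p.1 : Fin (n + 1) → ℝ) := by
  rw [snoc_eq_piFinSuccAbove_symm]
  exact (MeasurableEquiv.piFinSuccAbove (fun _ : Fin (n + 1) => ℝ) (Fin.last n)).symm.measurableEmbedding

/-- `(s, x) ↦ Fin.snoc x s` is measure preserving from `volume.prod volume` on `ℝ × ℝⁿ` to Lebesgue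
measure on `ℝⁿ⁺¹` (`MeasureTheory.volume_preserving_piFinSuccAbove` at `Fin.last n`). [folklore] -/
theorem measurePreserving_snoc :
    MeasurePreserving (fun p : ℝ × (Fin n → ℝ) => (Fin.snoc p.2 p.1 : Fin (n + 1) → ℝ))
      ((volume : Measure ℝ).prod (volume : Measure (Fin n → ℝ))) volume := by
  rw [snoc_eq_piFinSuccAbove_symm, ← Measure.volume_eq_prod]
  exact (volume_preserving_piFinSuccAbove (fun _ : Fin (n + 1) => ℝ) (Fin.last n)).symm _

/-- Change of variables `z = Fin.snoc x s` in an integral over `ℝⁿ⁺¹`. [folklore] -/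
theorem integral_comp_snoc (g : (Fin (n + 1) → ℝ) → ℝ) :
    ∫ p : ℝ × (Fin n → ℝ), g (Fin.snoc p.2 p.1)
        ∂((volume : Measure ℝ).prod (volume : Measure (Fin n → ℝ))) = ∫ z, g z :=
  measurePreserving_snoc.integral_comp measurableEmbedding_snoc g

/-! ### Fubini over the last coordinate -/

section Slice

variable {D : Set (Fin (n + 1) → ℝ)} {F : (Fin (n + 1) → ℝ) → ℝ}

/-- An integrable set integrand extended by zero, composed with `(s, x) ↦ Fin.snoc x s`, is integrable
for the product measure on `ℝ × ℝⁿ`. [folklore] -/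
theorem integrable_indicator_comp_snoc (hD : MeasurableSet D) (hF : IntegrableOn F D) :
    Integrable (fun p : ℝ × (Fin n → ℝ) => D.indicator F (Fin.snoc p.2 p.1))
      ((volume : Measure ℝ).prod (volume : Measure (Fin n → ℝ))) :=
  (measurePreserving_snoc.integrable_comp_emb measurableEmbedding_snoc).mpr
    ((integrable_indicator_iff hD).mpr hF)

/-- The slice at `s` of the integrand extended by zero integrates to the slice set-integral. [folklore] -/
theorem integral_indicator_comp_snoc (hD : MeasurableSet D) (s : ℝ) :
    ∫ x, D.indicator F (Fin.snoc x s) =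
      ∫ x in {x : Fin n → ℝ | (Fin.snoc x s : Fin (n + 1) → ℝ) ∈ D}, F (Fin.snoc x s) := by
  rw [← integral_indicator (measurableSet_lastSlice hD s)]
  rfl

/-- **Fubini over the last coordinate**: the slice set-integrals integrate to the set integral,
`∫ s, (∫ x in {x | snoc x s ∈ D}, F (snoc x s)) = ∫ z in D, F z`. [folklore] -/
theorem integral_integral_lastSlice (hD : MeasurableSet D) (hF : IntegrableOn F D) :
    ∫ s, ∫ x in {x : Fin n → ℝ | (Fin.snoc x s : Fin (n + 1) → ℝ) ∈ D}, F (Fin.snoc x s) =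
      ∫ z in D, F z := by
  calc ∫ s, ∫ x in {x : Fin n → ℝ | (Fin.snoc x s : Fin (n + 1) → ℝ) ∈ D}, F (Fin.snoc x s)
      = ∫ s, ∫ x, D.indicator F (Fin.snoc x s) := by
        simp_rw [integral_indicator_comp_snoc hD]
    _ = ∫ p : ℝ × (Fin n → ℝ), D.indicator F (Fin.snoc p.2 p.1)
          ∂((volume : Measure ℝ).prod (volume : Measure (Fin n → ℝ))) :=
        (integral_prod _ (integrable_indicator_comp_snoc hD hF)).symm
    _ = ∫ z, D.indicator F z := integral_comp_snoc _
    _ = ∫ z in D, F z := integral_indicator hD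

/-- The slice set-integrals `s ↦ ∫ x in {x | snoc x s ∈ D}, F (snoc x s)` form an integrable function
of the parameter `s`. [folklore] -/
theorem integrable_integral_lastSlice (hD : MeasurableSet D) (hF : IntegrableOn F D) :
    Integrable fun s : ℝ =>
      ∫ x in {x : Fin n → ℝ | (Fin.snoc x s : Fin (n + 1) → ℝ) ∈ D}, F (Fin.snoc x s) := by
  simp_rw [← integral_indicator_comp_snoc hD]
  exact (integrable_indicator_comp_snoc hD hF).integral_prod_left

/-- Almost every last-coordinate slice of an integrable set integrand is absolutely integrable on the
slice of the set. [folklore] -/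
theorem ae_integrableOn_lastSlice (hD : MeasurableSet D) (hF : IntegrableOn F D) :
    ∀ᵐ s : ℝ, IntegrableOn (fun x : Fin n → ℝ => F (Fin.snoc x s))
      {x : Fin n → ℝ | (Fin.snoc x s : Fin (n + 1) → ℝ) ∈ D} := by
  filter_upwards [(integrable_indicator_comp_snoc hD hF).prod_right_ae] with s hs
  exact (integrable_indicator_iff (μ := volume)
    (f := fun x : Fin n → ℝ => F (Fin.snoc x s)) (measurableSet_lastSlice hD s)).mp hs

end Slice

/-! ### Raw fibre evaluations on `Fin 2 → ℝ` -/

/-- The triangle `{e₁ < z₁ < z₀ < x} ⊆ ℝ²` is measurable. [folklore] -/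
theorem measurableSet_triangle (x e₁ : ℝ) :
    MeasurableSet {z : Fin 2 → ℝ | e₁ < z 1 ∧ z 1 < z 0 ∧ z 0 < x} := by
  simp only [setOf_and]
  exact (measurableSet_lt measurable_const (measurable_pi_apply 1)).inter
    ((measurableSet_lt (measurable_pi_apply 1) (measurable_pi_apply 0)).inter
      (measurableSet_lt (measurable_pi_apply 0) measurable_const))

/-- The quadrant `{x < z₀, e₁ < z₁} ⊆ ℝ²` is measurable. [folklore] -/
theorem measurableSet_quadrant (x e₁ : ℝ) :
    MeasurableSet {z : Fin 2 → ℝ | x < z 0 ∧ e₁ < z 1} := by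
  simp only [setOf_and]
  exact (measurableSet_lt measurable_const (measurable_pi_apply 0)).inter
    (measurableSet_lt measurable_const (measurable_pi_apply 1))

/-- **Raw value of a quadrant integral with product integrand**: if `F = φ(z₀)ψ(z₁)` on
`{x < z₀, e₁ < z₁}`, then `∫ F = (∫_{x}^{∞} φ)(∫_{e₁}^{∞} ψ)` (no integrability needed). [folklore] -/
theorem setIntegral_quadrant_eq (x e₁ : ℝ) (φ ψ : ℝ → ℝ) (F : (Fin 2 → ℝ) → ℝ)
    (hint : EqOn F (fun z => φ (z 0) * ψ (z 1)) {z | x < z 0 ∧ e₁ < z 1}) :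
    ∫ z in {z : Fin 2 → ℝ | x < z 0 ∧ e₁ < z 1}, F z = (∫ a in Ioi x, φ a) * (∫ b in Ioi e₁, ψ b) := by
  rw [setIntegral_congr_fun (measurableSet_quadrant x e₁) hint, setIntegral_fin_two_eq_prod]
  have hset : (fun p : ℝ × ℝ => (![p.1, p.2] : Fin 2 → ℝ)) ⁻¹' {z : Fin 2 → ℝ | x < z 0 ∧ e₁ < z 1} =
      Ioi x ×ˢ Ioi e₁ := by
    ext p
    simp [mem_prod]
  rw [hset]
  simp only [Matrix.cons_val_zero, Matrix.cons_val_one]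
  exact setIntegral_prod_mul φ ψ (Ioi x) (Ioi e₁)

/-- **Raw value of a triangle integral**: if `F = z₁/(√f(z₁)√f(z₀))` on `T = {e₁ < z₁ < z₀ < x}` and `F`
is integrable on `T`, then `∫_T F = ∫_{e₁}^{x} (∫_{e₁}^{a} b/√f(b) db)(√f(a))⁻¹ da`. [folklore] -/
theorem setIntegral_triangle_eq (x e₁ : ℝ) (f : ℝ → ℝ) (F : (Fin 2 → ℝ) → ℝ)
    (hF : IntegrableOn F {z : Fin 2 → ℝ | e₁ < z 1 ∧ z 1 < z 0 ∧ z 0 < x})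
    (hint : EqOn F (fun z => z 1 / (Real.sqrt (f (z 1)) * Real.sqrt (f (z 0))))
      {z | e₁ < z 1 ∧ z 1 < z 0 ∧ z 0 < x}) :
    ∫ z in {z : Fin 2 → ℝ | e₁ < z 1 ∧ z 1 < z 0 ∧ z 0 < x}, F z =
      ∫ a in Ioo e₁ x, (∫ b in Ioo e₁ a, b / Real.sqrt (f b)) * (Real.sqrt (f a))⁻¹ := by
  set G : ℝ × ℝ → ℝ := fun p => p.2 / (Real.sqrt (f p.2) * Real.sqrt (f p.1)) with hG
  set T : Set (ℝ × ℝ) := {p | e₁ < p.2 ∧ p.2 < p.1 ∧ p.1 < x} with hT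
  have hTm : MeasurableSet T := by
    simp only [hT, setOf_and]
    exact (measurableSet_lt measurable_const measurable_snd).inter
      ((measurableSet_lt measurable_snd measurable_fst).inter
        (measurableSet_lt measurable_fst measurable_const))
  have hset : (fun p : ℝ × ℝ => (![p.1, p.2] : Fin 2 → ℝ)) ⁻¹'
      {z : Fin 2 → ℝ | e₁ < z 1 ∧ z 1 < z 0 ∧ z 0 < x} = T := by
    ext p
    simp [hT]
  -- integrability of `G` on `T`, transported
  have hGint : IntegrableOn G T (volume.prod volume) := by
    have h := integrableOn_prod_of_fin_two hF
    rw [hset] at h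
    refine h.congr_fun (fun p hp => ?_) hTm
    have hp' : (![p.1, p.2] : Fin 2 → ℝ) ∈ {z : Fin 2 → ℝ | e₁ < z 1 ∧ z 1 < z 0 ∧ z 0 < x} := by
      rw [← hset] at hp; exact hp
    show F ![p.1, p.2] = G p
    rw [hint hp']
    simp [hG]
  rw [setIntegral_congr_fun (measurableSet_triangle x e₁) hint, setIntegral_fin_two_eq_prod, hset]
  simp only [Matrix.cons_val_zero, Matrix.cons_val_one]
  change ∫ p in T, G p ∂(volume.prod volume) = _
  -- Fubini over the square
  have hTsub : T ⊆ Ioo e₁ x ×ˢ Ioo e₁ x := by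
    intro p hp
    exact ⟨⟨lt_trans hp.1 hp.2.1, hp.2.2⟩, ⟨hp.1, hp.2.1.trans hp.2.2⟩⟩
  have h1 : ∫ p in T, G p ∂(volume.prod volume) =
      ∫ p in Ioo e₁ x ×ˢ Ioo e₁ x, T.indicator G p ∂(volume.prod volume) := by
    rw [setIntegral_indicator hTm, inter_eq_self_of_subset_right hTsub]
  have hind : IntegrableOn (T.indicator G) (Ioo e₁ x ×ˢ Ioo e₁ x) (volume.prod volume) :=
    (integrable_indicator_iff hTm |>.mpr hGint).integrableOn
  rw [h1, setIntegral_prod _ hind]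
  refine setIntegral_congr_fun measurableSet_Ioo fun a ha => ?_
  have hfib : ∀ b, T.indicator G (a, b) = (Ioo e₁ a).indicator
      (fun b => b / Real.sqrt (f b) * (Real.sqrt (f a))⁻¹) b := by
    intro b
    by_cases hb : b ∈ Ioo e₁ a
    · have hab : (a, b) ∈ T := ⟨hb.1, hb.2, ha.2⟩
      rw [indicator_of_mem hab, indicator_of_mem hb, hG]
      simp only
      rw [div_mul_eq_div_div, div_eq_mul_inv (b / Real.sqrt (f b))]
    · have hab : (a, b) ∉ T := fun h => hb ⟨h.1, h.2.1⟩
      rw [indicator_of_notMem hab, indicator_of_notMem hb]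
  simp_rw [hfib]
  rw [setIntegral_indicator measurableSet_Ioo,
    show Ioo e₁ x ∩ Ioo e₁ a = Ioo e₁ a from
      inter_eq_self_of_subset_right (Ioo_subset_Ioo le_rfl ha.2.le),
    integral_mul_const]

/-! ### The log box -/

/-- `∫₀¹ (b − 1)/(1 + u(b − 1)) du = log b` for every `b > 0` (the primitive `log (1 + u(b−1))`;
`1 + u(b−1) = (1−u) + u b > 0` on `[0,1]` for both signs of `b − 1`). [folklore] -/
theorem integral_logBox_fibre {b : ℝ} (hb : 0 < b) :
    ∫ u in Ioo (0 : ℝ) 1, (b - 1) / (1 + u * (b - 1)) = Real.log b := by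
  have hpos : ∀ u ∈ uIcc (0 : ℝ) 1, 0 < 1 + u * (b - 1) := fun u hu => by
    rw [uIcc_of_le zero_le_one] at hu
    rcases le_or_gt 1 b with hb1 | hb1
    · nlinarith [mul_nonneg hu.1 (sub_nonneg.mpr hb1)]
    · have := mul_le_mul_of_nonpos_right hu.2 (sub_neg.mpr hb1).le
      linarith
  have hderiv : ∀ u ∈ uIcc (0 : ℝ) 1,
      HasDerivAt (fun u => Real.log (1 + u * (b - 1))) ((b - 1) / (1 + u * (b - 1))) u := by
    intro u hu
    have h1 : HasDerivAt (fun u : ℝ => 1 + u * (b - 1)) (b - 1) u := by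
      simpa using ((hasDerivAt_id u).mul_const (b - 1)).const_add 1
    convert h1.log (hpos u hu).ne' using 1
  have hcont : ContinuousOn (fun u : ℝ => (b - 1) / (1 + u * (b - 1))) (Icc 0 1) :=
    continuousOn_const.div (by fun_prop) fun u hu => (hpos u (by rwa [uIcc_of_le zero_le_one])).ne'
  rw [← integral_Ioc_eq_integral_Ioo, ← intervalIntegral.integral_of_le zero_le_one,
    intervalIntegral.integral_eq_sub_of_hasDerivAt hderiv (hcont.intervalIntegrable_of_Icc zero_le_one)]
  simp

/-- The box `{0 < w₀ < 1, t₀ < w₁ < t₁} ⊆ ℝ²` pulls back to `(0,1) × (t₀,t₁)` along `p ↦ ![p.1, p.2]`. -/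
theorem preimage_box (t₀ t₁ : ℝ) :
    (fun p : ℝ × ℝ => (![p.1, p.2] : Fin 2 → ℝ)) ⁻¹'
        {w : Fin 2 → ℝ | 0 < w 0 ∧ w 0 < 1 ∧ t₀ < w 1 ∧ w 1 < t₁} = Ioo 0 1 ×ˢ Ioo t₀ t₁ := by
  ext p
  simp [mem_prod, and_assoc]

/-- Transported integrability of a log-box representation: `(u, t) ↦ (B t − 1)/(1 + u (B t − 1))` is
integrable for `(volume.restrict (0,1)).prod (volume.restrict (t₀,t₁))`. [folklore] -/
theorem integrable_logBox_prod (B : ℝ → ℝ) (t₀ t₁ : ℝ) (r : KZ.IntegralRep 2)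
    (hdom : r.domain = {w | 0 < w 0 ∧ w 0 < 1 ∧ t₀ < w 1 ∧ w 1 < t₁})
    (hint : EqOn r.integrand (fun w => (B (w 1) - 1) / (1 + w 0 * (B (w 1) - 1))) r.domain) :
    Integrable (fun p : ℝ × ℝ => (B p.2 - 1) / (1 + p.1 * (B p.2 - 1)))
      ((volume.restrict (Ioo 0 1)).prod (volume.restrict (Ioo t₀ t₁))) := by
  have h := integrableOn_prod_of_fin_two r.integrableOn
  rw [hdom, preimage_box] at h
  have h' : IntegrableOn (fun p : ℝ × ℝ => (B p.2 - 1) / (1 + p.1 * (B p.2 - 1)))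
      (Ioo 0 1 ×ˢ Ioo t₀ t₁) (volume.prod volume) := by
    refine h.congr_fun (fun p hp => ?_) (measurableSet_Ioo.prod measurableSet_Ioo)
    have hp' : (![p.1, p.2] : Fin 2 → ℝ) ∈ r.domain := by
      rw [hdom]
      simp only [mem_setOf_eq, Matrix.cons_val_zero, Matrix.cons_val_one]
      exact ⟨hp.1.1, hp.1.2, hp.2.1, hp.2.2⟩
    show r.integrand ![p.1, p.2] = _
    rw [hint hp']
    simp
  rw [Measure.prod_restrict]
  exact h'

/-- **Value of a log-box representation**: if `r.domain = {0 < w₀ < 1, t₀ < w₁ < t₁}`,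
`r.integrand = (B(w₁) − 1)/(1 + w₀ (B(w₁) − 1))` on it and `B > 0` on `(t₀, t₁)`, then
`r.value = ∫_{t₀}^{t₁} log B(t) dt`. [folklore] -/
theorem value_logBox_eq (B : ℝ → ℝ) (t₀ t₁ : ℝ) (r : KZ.IntegralRep 2)
    (hdom : r.domain = {w | 0 < w 0 ∧ w 0 < 1 ∧ t₀ < w 1 ∧ w 1 < t₁})
    (hint : EqOn r.integrand (fun w => (B (w 1) - 1) / (1 + w 0 * (B (w 1) - 1))) r.domain)
    (hB : ∀ t ∈ Ioo t₀ t₁, 0 < B t) :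
    r.value = ∫ t in Ioo t₀ t₁, Real.log (B t) := by
  have hGint := integrable_logBox_prod B t₀ t₁ r hdom hint
  rw [KZ.IntegralRep.value, setIntegral_congr_fun (KZ.IntegralRep.measurableSet_domain_holds r) hint,
    setIntegral_fin_two_eq_prod, hdom, preimage_box]
  simp only [Matrix.cons_val_zero, Matrix.cons_val_one]
  change ∫ p in Ioo 0 1 ×ˢ Ioo t₀ t₁, (fun p : ℝ × ℝ => (B p.2 - 1) / (1 + p.1 * (B p.2 - 1))) p
    ∂(volume.prod volume) = _
  rw [← Measure.prod_restrict, integral_prod_symm _ hGint]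
  refine setIntegral_congr_fun measurableSet_Ioo fun t ht => ?_
  exact integral_logBox_fibre (hB t ht)

/-- **Integrability of `log B` on the arc** from a log-box representation (`B > 0` on the arc): the
`t`-marginal of the box integrand is `log B(t)`. [folklore] -/
theorem integrableOn_log_of_logBox (B : ℝ → ℝ) (t₀ t₁ : ℝ) (r : KZ.IntegralRep 2)
    (hdom : r.domain = {w | 0 < w 0 ∧ w 0 < 1 ∧ t₀ < w 1 ∧ w 1 < t₁})
    (hint : EqOn r.integrand (fun w => (B (w 1) - 1) / (1 + w 0 * (B (w 1) - 1))) r.domain)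
    (hB : ∀ t ∈ Ioo t₀ t₁, 0 < B t) :
    IntegrableOn (fun t => Real.log (B t)) (Ioo t₀ t₁) := by
  have hGint := integrable_logBox_prod B t₀ t₁ r hdom hint
  have h := hGint.integral_prod_right
  refine IntegrableOn.congr_fun (f := fun t => ∫ u in Ioo (0 : ℝ) 1, (B t - 1) / (1 + u * (B t - 1)))
    h (fun t ht => ?_) measurableSet_Ioo
  exact integral_logBox_fibre (hB t ht)

end Summit.KontsevichZagierPeriods.KontsevichZagierPeriods.TorsionLogs.NeronTorsionModularArc

end
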